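import Literature.Computability.Complexity.Hastad3SatCNF
import HarnessLib

/-!
# Håstad's 3-SAT test as an E3-CNF: clause counts and the value bound (Thm 6.5, formula level)

Continuation of `Hastad3SatCNF.lean` (Håstad 2001, proof of Thm 6.5 / Thm 5.4: "weights are turned
into multiplicities").  For a unit-weight projection game `G`, the CNF `D.hCNF` of the nondegenerate
test triples with multiplicities `mult = p^{#flips} (q-p)^{K-#flips} (2q)^{K⋆-K}` has its clause counts
tied to the acceptance probability of Test `3S^ε`, `ε = p/q`, as follows (everything PROVED):

* `mult_eq` — `mult = (2q)^{K⋆-K} q^K · flipWt ε fl`, so that over ALL triples at an edge the weighted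
  acceptance is `Z · accProb_e` with the uniform normaliser `Z = 2^{|α|} (2q)^{K⋆}` (`sum_mult_accInd`),
  and the total weight is `Z` (`sum_mult`);
* the dropped triples: masks identically false weigh at most `2^{-r} Z` per edge when every projection
  image has at least `r` points (`sum_deg0_le`), masks identically true weigh at most `(2^{-r} + ε) Z`
  (`sum_deg1_le`) and their clauses are always satisfied (`accInd_deg1`);
* `length_hCNF`, `countP_hCNF` — the number of (satisfied) clauses as sums over nondegenerate triples;
* **`satisfiedFraction_hCNF_le`** — if every pair of folded tables is accepted by the test on `G` with
  probability at most `τ ≤ 1`, then every assignment satisfies at most a fraction `τ + 2^{1-r}` of the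
  clauses of `D.hCNF` (for `ε ≤ 1/4`, `r ≥ 3`); hence `maxSatFraction ≤ τ + 2^{1-r}`
  (`maxSatFraction_hCNF_le`).

Together with `satisfiable_hCNF`, `isExactWidth_hCNF` (previous file) and `testAcc_soundness`
(`Hastad3SatGame.lean`) this is Håstad's Theorem 6.5 at the level of formulas, for any smooth
projection game of small value in place of the `u`-parallel two-prover protocol.

## References

* J. Håstad, *Some optimal inapproximability results*, J. ACM 48 (2001) 798–859, §5 (proof of Thm 5.4)
  and §6.1 (proof of Thm 6.5) [Hastad2001].
-/

noncomputable section

namespace Literature.Computability.Complexity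

namespace ProjGame

namespace CNFData

open Finset Literature.Probability.RandomGraphs.LowDegree Literature.Computability.Complexity.LongCode
  Literature.Computability.Complexity.Hastad3Sat

variable {E V U β α : Type} [Fintype E] [Fintype V] [Fintype U] [Fintype β] [Fintype α]
  [DecidableEq E] [DecidableEq V] [DecidableEq U] [DecidableEq β] [DecidableEq α]
  {G : ProjGame E V U β α} (D : G.CNFData)

/-- `ε = p / q`. [cite: Hastad2001, §6.1] -/
def eps : ℝ := (D.p : ℝ) / D.q

/-- The uniform normaliser `Z = 2^{|α|} (2q)^{K⋆}`: the total multiplicity of the triples at an edge.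
[cite: Hastad2001, §5 (proof of Thm 5.4)] -/
def Z : ℝ := (2 : ℝ) ^ Fintype.card α * (2 * (D.q : ℝ)) ^ D.Kstar

/-! ### Multiplicities as scaled flip weights -/

omit [Fintype V] [Fintype U] [Fintype α] [DecidableEq E] [DecidableEq U] [DecidableEq β] [DecidableEq α] in
/-- `q^K · flipWt (p/q) fl = p^{#flips} (q - p)^{K - #flips}`. [cite: Hastad2001, §5 (proof of Thm 5.4)] -/
theorem pow_mul_flipWt (hq : 0 < D.q) {v : V} (fl : G.Lab v → Bool) :
    (D.q : ℝ) ^ Fintype.card (G.Lab v) * flipWt D.eps fl =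
      (D.p : ℝ) ^ (univ.filter fun y => fl y = true).card *
        ((D.q : ℝ) - D.p) ^ (univ.filter fun y => fl y = false).card := by
  have hq' : (D.q : ℝ) ≠ 0 := by exact_mod_cast hq.ne'
  unfold flipWt
  rw [← card_univ, ← prod_const, ← prod_mul_distrib]
  have h : ∀ y : G.Lab v, (D.q : ℝ) * bitWt D.eps (fl y) = if fl y = true then (D.p : ℝ) else (D.q : ℝ) - D.p := by
    intro y
    unfold bitWt eps
    cases fl y
    · simp; field_simp
    · simp; field_simp
  rw [prod_congr rfl fun y _ => h y, prod_ite, prod_const, prod_const]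
  have hf : (univ.filter fun y : G.Lab v => ¬ fl y = true) = univ.filter fun y => fl y = false := by
    ext y; simp
  rw [hf]

omit [Fintype V] [Fintype U] [Fintype α] [DecidableEq E] [DecidableEq U] [DecidableEq β] [DecidableEq α] in
/-- **The multiplicity is the scaled flip weight**: `mult = (2q)^{K⋆-K} · q^K · flipWt ε fl`.
[cite: Hastad2001, §5 (proof of Thm 5.4)] -/
theorem mult_eq (hq : 0 < D.q) (t : Trip G) :
    (D.mult t : ℝ) = (2 * (D.q : ℝ)) ^ (D.Kstar - Fintype.card (G.Lab (G.src t.1))) *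
      ((D.q : ℝ) ^ Fintype.card (G.Lab (G.src t.1)) * flipWt D.eps t.2.2.2) := by
  rw [D.pow_mul_flipWt hq]
  unfold mult
  have hpq : ((D.q - D.p : ℕ) : ℝ) = (D.q : ℝ) - D.p := Nat.cast_sub D.p_le
  push_cast
  rw [hpq]
  ring

/-! ### Sums over the triples at an edge -/

omit [Fintype V] [Fintype U] [DecidableEq E] [DecidableEq U] in
/-- **Weighted acceptance over all triples at an edge** is `Z · accProb_e` (for `K ≤ K⋆`).
[cite: Hastad2001, §6.1 (the test as weighted clauses)] -/
theorem sum_mult_accInd (hq : 0 < D.q) (hK : ∀ v, Fintype.card (G.Lab v) ≤ D.Kstar) (e : E)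
    (A : (α → Bool) → Bool) (B : (G.Lab (G.src e) → Bool) → Bool) :
    ∑ f : α → Bool, ∑ g : G.Lab (G.src e) → Bool, ∑ fl : G.Lab (G.src e) → Bool,
        (D.mult ⟨e, f, g, fl⟩ : ℝ) * accInd (A f) (B g) (B (shift g (maskT ⟨e, f, g, fl⟩))) =
      D.Z * accProb D.eps (G.tproj (G.src e) (edgeAt e)) A B := by
  set K := Fintype.card (G.Lab (G.src e)) with hKdef
  set N := Fintype.card α with hN
  set π := G.tproj (G.src e) (edgeAt e) with hπ
  set c : ℝ := (2 * (D.q : ℝ)) ^ (D.Kstar - K) * (D.q : ℝ) ^ K with hc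
  have hden : (2 : ℝ) ^ N * 2 ^ K ≠ 0 := by positivity
  -- pull the constant factor out of the triple sum and reorder
  have e1 : ∀ (f : α → Bool) (g fl : G.Lab (G.src e) → Bool),
      (D.mult ⟨e, f, g, fl⟩ : ℝ) * accInd (A f) (B g) (B (shift g (maskT ⟨e, f, g, fl⟩))) =
        c * (flipWt D.eps fl * accInd (A f) (B g) (B (shift g (mask π f fl)))) := by
    intro f g fl
    rw [D.mult_eq hq]
    simp only [maskT, hc, ← hπ]
    ring
  have hL : ∑ f : α → Bool, ∑ g : G.Lab (G.src e) → Bool, ∑ fl : G.Lab (G.src e) → Bool,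
        (D.mult ⟨e, f, g, fl⟩ : ℝ) * accInd (A f) (B g) (B (shift g (maskT ⟨e, f, g, fl⟩))) =
      c * ∑ f : α → Bool, ∑ fl : G.Lab (G.src e) → Bool, ∑ g : G.Lab (G.src e) → Bool,
        flipWt D.eps fl * accInd (A f) (B g) (B (shift g (mask π f fl))) := by
    calc _ = ∑ f : α → Bool, ∑ g : G.Lab (G.src e) → Bool, ∑ fl : G.Lab (G.src e) → Bool,
          c * (flipWt D.eps fl * accInd (A f) (B g) (B (shift g (mask π f fl)))) := by
          simp_rw [e1]
      _ = c * ∑ f : α → Bool, ∑ g : G.Lab (G.src e) → Bool, ∑ fl : G.Lab (G.src e) → Bool,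
          flipWt D.eps fl * accInd (A f) (B g) (B (shift g (mask π f fl))) := by
          simp_rw [mul_sum]
      _ = _ := by
          congr 1
          exact sum_congr rfl fun f _ => sum_comm
  have hZ : D.Z = c * (2 ^ N * 2 ^ K) := by
    unfold Z
    rw [← hN, hc]
    have hsplit : (2 * (D.q : ℝ)) ^ D.Kstar = (2 * (D.q : ℝ)) ^ (D.Kstar - K) * (2 * (D.q : ℝ)) ^ K := by
      rw [← pow_add, Nat.sub_add_cancel (hK _)]
    rw [hsplit, mul_pow]
    ring
  rw [hL, hZ]
  unfold accProb
  rw [← hKdef, ← hN]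
  field_simp

omit [Fintype V] [Fintype U] [DecidableEq E] [DecidableEq U] in
/-- **Total multiplicity at an edge** is `Z`. [cite: Hastad2001, §5 (proof of Thm 5.4)] -/
theorem sum_mult (hq : 0 < D.q) (hK : ∀ v, Fintype.card (G.Lab v) ≤ D.Kstar) (e : E) :
    ∑ f : α → Bool, ∑ g : G.Lab (G.src e) → Bool, ∑ fl : G.Lab (G.src e) → Bool,
        (D.mult ⟨e, f, g, fl⟩ : ℝ) = D.Z := by
  have h := D.sum_mult_accInd hq hK e (fun _ => true) (fun _ => true)
  simp only [accInd, Bool.true_or, if_true, mul_one] at h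
  rw [h]
  -- the always-accepting tables are accepted with probability one
  have h1 : accProb D.eps (G.tproj (G.src e) (edgeAt e)) (fun _ => true) (fun _ => true) = 1 := by
    unfold accProb
    simp only [accInd, Bool.true_or, if_true, mul_one, sum_const, card_univ, Fintype.card_fun,
      Fintype.card_bool]
    rw [← smul_sum, sum_flipWt, nsmul_eq_mul, nsmul_eq_mul, mul_one]
    push_cast
    field_simp
  rw [h1, mul_one]

/-! ### The dropped triples -/

omit [Fintype E] [Fintype V] [Fintype U] [Fintype β] [DecidableEq E] [DecidableEq V] [DecidableEq U]
  [DecidableEq β] in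
/-- The number of `f : α → Bool` identically `b₀` on a set `S`: `2^{|α| - |S|}`, in the form
`#{f} · 2^{|S|} = 2^{|α|}`. [folklore] -/
theorem card_const_on (S : Finset α) (b₀ : Bool) :
    ((univ.filter fun f : α → Bool => ∀ x ∈ S, f x = b₀).card : ℝ) * 2 ^ S.card = 2 ^ Fintype.card α := by
  -- `#{f} = ∑_f ∏_{x ∈ S} [f x = b₀] = ∏_x (1 or 2)`
  have h1 : ((univ.filter fun f : α → Bool => ∀ x ∈ S, f x = b₀).card : ℝ) =
      ∑ f : α → Bool, ∏ x, (if x ∈ S then (if f x = b₀ then (1 : ℝ) else 0) else 1) := by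
    rw [← sum_boole ]
    refine sum_congr rfl fun f _ => ?_
    by_cases hf : ∀ x ∈ S, f x = b₀
    · rw [if_pos hf]
      exact (prod_eq_one fun x _ => by by_cases hx : x ∈ S <;> simp [hx, hf x]).symm
    · rw [if_neg hf]
      push Not at hf
      obtain ⟨x, hx, hfx⟩ := hf
      exact (prod_eq_zero (mem_univ x) (by simp [hx, hfx])).symm
  rw [h1, ← Fintype.prod_sum fun x b => if x ∈ S then (if b = b₀ then (1 : ℝ) else 0) else 1]
  have h2 : ∀ x, ∑ b : Bool, (if x ∈ S then (if b = b₀ then (1 : ℝ) else 0) else 1) =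
      if x ∈ S then 1 else 2 := by
    intro x
    by_cases hx : x ∈ S
    · simp only [hx, if_true]
      cases b₀ <;> simp
    · simp only [hx, if_false]
      norm_num
  simp_rw [h2]
  rw [prod_ite, prod_const, prod_const, one_pow, one_mul, ← pow_add]
  congr 1
  have h4 : (univ.filter fun x => ¬ x ∈ S) = Sᶜ := by ext; simp
  rw [h4, card_compl, Nat.sub_add_cancel (card_le_univ S)]

omit [Fintype V] [Fintype U] [DecidableEq E] [DecidableEq U] in
/-- **Masks identically false are rare**: at an edge whose projection image has at least `r` points,
the triples with mask `≡ false` (they need `f ≡ true` on the image and no flip) weigh at most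
`2^{-r} Z`. [cite: Hastad2001, §6.1 (Thm 6.5: E3 clauses)] -/
theorem sum_deg0_le (hq : 0 < D.q) (hK : ∀ v, Fintype.card (G.Lab v) ≤ D.Kstar) (e : E) {r : ℕ}
    (hr : r ≤ ((univ : Finset (G.Lab (G.src e))).image (G.tproj (G.src e) (edgeAt e))).card) :
    ∑ f : α → Bool, ∑ g : G.Lab (G.src e) → Bool, ∑ fl : G.Lab (G.src e) → Bool,
        (if (∀ y, maskT ⟨e, f, g, fl⟩ y = false) then (D.mult ⟨e, f, g, fl⟩ : ℝ) else 0) ≤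
      D.Z / 2 ^ r := by
  set π := G.tproj (G.src e) (edgeAt e) with hπ
  set K := Fintype.card (G.Lab (G.src e)) with hKdef
  set N := Fintype.card α with hN
  set S := (univ : Finset (G.Lab (G.src e))).image π with hS
  have hq0 : (0 : ℝ) < D.q := by exact_mod_cast hq
  -- the mask is identically false iff `f ≡ true` on the image and `fl ≡ false`
  have hmask : ∀ (f : α → Bool) (g fl : G.Lab (G.src e) → Bool), (∀ y, maskT ⟨e, f, g, fl⟩ y = false) ↔
      (∀ x ∈ S, f x = true) ∧ fl = fun _ => false := by
    intro f g fl
    simp only [maskT, mask, hS, mem_image, mem_univ, true_and, forall_exists_index,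
      forall_apply_eq_imp_iff]
    constructor
    · intro h
      refine ⟨fun y => ?_, funext fun y => ?_⟩
      · have := h y
        revert this
        cases f (π y) <;> simp
      · have := h y
        revert this
        cases hf : f (G.tproj (G.src e) (edgeAt e) y) <;> simp
    · rintro ⟨hf, rfl⟩ y
      simp [← hπ, hf y]
  -- the multiplicity of such a triple: `(q - p)^K (2q)^{K⋆ - K}`
  set cK : ℝ := ((D.q : ℝ) - D.p) ^ K * (2 * (D.q : ℝ)) ^ (D.Kstar - K) with hcK
  have hmult : ∀ (f : α → Bool) (g : G.Lab (G.src e) → Bool),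
      (D.mult ⟨e, f, g, fun _ => false⟩ : ℝ) = cK := by
    intro f g
    have hpq : ((D.q - D.p : ℕ) : ℝ) = (D.q : ℝ) - D.p := Nat.cast_sub D.p_le
    have h0 : (univ.filter fun _y : G.Lab (G.src e) => false = true).card = 0 := by simp
    have h1 : (univ.filter fun _y : G.Lab (G.src e) => false = false).card = K := by simp [hKdef]
    show ((D.p ^ (univ.filter fun _y : G.Lab (G.src e) => false = true).card *
      (D.q - D.p) ^ (univ.filter fun _y : G.Lab (G.src e) => false = false).card *
        (2 * D.q) ^ (D.Kstar - Fintype.card (G.Lab (G.src e))) : ℕ) : ℝ) = cK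
    rw [h0, h1, ← hKdef, pow_zero, one_mul]
    push_cast
    rw [hpq]
  calc ∑ f : α → Bool, ∑ g : G.Lab (G.src e) → Bool, ∑ fl : G.Lab (G.src e) → Bool,
        (if (∀ y, maskT ⟨e, f, g, fl⟩ y = false) then (D.mult ⟨e, f, g, fl⟩ : ℝ) else 0)
      = ∑ f : α → Bool, ∑ _g : G.Lab (G.src e) → Bool, (if (∀ x ∈ S, f x = true) then cK else 0) := by
        refine sum_congr rfl fun f _ => sum_congr rfl fun g _ => ?_
        by_cases hf : ∀ x ∈ S, f x = true
        · rw [if_pos hf]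
          have hfl : ∀ fl : G.Lab (G.src e) → Bool,
              (if (∀ y, maskT ⟨e, f, g, fl⟩ y = false) then (D.mult ⟨e, f, g, fl⟩ : ℝ) else 0) =
                if fl = (fun _ => false) then cK else 0 := by
            intro fl
            by_cases hm : ∀ y, maskT ⟨e, f, g, fl⟩ y = false
            · obtain ⟨-, hfl0⟩ := (hmask f g fl).1 hm
              rw [if_pos hm, if_pos hfl0]
              subst hfl0
              exact hmult f g
            · rw [if_neg hm, if_neg (fun h => hm ((hmask f g fl).2 ⟨hf, h⟩))]
          rw [sum_congr rfl fun fl _ => hfl fl, sum_ite_eq' univ (fun _ : G.Lab (G.src e) => false),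
            if_pos (mem_univ _)]
        · rw [if_neg hf]
          refine sum_eq_zero fun fl _ => ?_
          rw [if_neg (fun hm => hf ((hmask f g fl).1 hm).1)]
    _ = ∑ f : α → Bool, (2 : ℝ) ^ K * (if (∀ x ∈ S, f x = true) then cK else 0) := by
        refine sum_congr rfl fun f _ => ?_
        rw [sum_const, card_univ, Fintype.card_fun, Fintype.card_bool, ← hKdef, nsmul_eq_mul]
        push_cast
        ring
    _ = ((univ.filter fun f : α → Bool => ∀ x ∈ S, f x = true).card : ℝ) * (2 ^ K * cK) := by
        rw [← mul_sum, ← sum_filter, sum_const, nsmul_eq_mul]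
        ring
    _ ≤ (2 : ℝ) ^ N / 2 ^ r * (2 ^ K * ((D.q : ℝ) ^ K * (2 * (D.q : ℝ)) ^ (D.Kstar - K))) := by
        rw [hcK]
        have hcard : ((univ.filter fun f : α → Bool => ∀ x ∈ S, f x = true).card : ℝ) ≤ 2 ^ N / 2 ^ r := by
          rw [le_div_iff₀ (by positivity)]
          calc ((univ.filter fun f : α → Bool => ∀ x ∈ S, f x = true).card : ℝ) * 2 ^ r
              ≤ ((univ.filter fun f : α → Bool => ∀ x ∈ S, f x = true).card : ℝ) * 2 ^ S.card :=
                mul_le_mul_of_nonneg_left (pow_le_pow_right₀ (by norm_num) hr) (Nat.cast_nonneg _)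
            _ = 2 ^ N := card_const_on S true
        have hpq : (D.p : ℝ) ≤ D.q := by exact_mod_cast D.p_le
        have hp0 : (0 : ℝ) ≤ D.p := Nat.cast_nonneg _
        have hqp : ((D.q : ℝ) - D.p) ^ K ≤ (D.q : ℝ) ^ K :=
          pow_le_pow_left₀ (by linarith) (by linarith) K
        exact mul_le_mul hcard (mul_le_mul_of_nonneg_left (mul_le_mul_of_nonneg_right hqp
          (by positivity)) (by positivity)) (by positivity) (by positivity)
    _ = D.Z / 2 ^ r := by
        unfold Z
        rw [← hN]
        have hsplit : (2 * (D.q : ℝ)) ^ D.Kstar = (2 * (D.q : ℝ)) ^ (D.Kstar - K) * (2 * (D.q : ℝ)) ^ K := by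
          rw [← pow_add, Nat.sub_add_cancel (hK _)]
        rw [hsplit, mul_pow]
        ring

omit [Fintype E] [Fintype V] [Fintype U] [Fintype β] [Fintype α] [DecidableEq E] [DecidableEq V]
  [DecidableEq U] [DecidableEq β] [DecidableEq α] in
/-- **Masks identically true give tautologies**: for a folded `B`, the clause `A(f) ∨ B(g) ∨ B(g ⊕ 1)`
is always satisfied. [cite: Hastad2001, §6.1] -/
theorem accInd_deg1 {κ : Type} {B : (κ → Bool) → Bool} (hB : IsFolded B) (a : Bool) (g m : κ → Bool)
    (hm : ∀ y, m y = true) : accInd a (B g) (B (shift g m)) = 1 := by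
  have hshift : shift g m = fun y => !g y := by
    funext y; simp [shift, hm y]
  rw [hshift, hB g]
  unfold accInd
  cases B g <;> simp

omit [Fintype V] [Fintype U] [DecidableEq E] [DecidableEq U] in
/-- **Masks identically true are rare or cheap**: at an edge whose projection image has at least `r`
points, the triples with mask `≡ true` (every `y` with `f(π y)` true is flipped) weigh at most
`(2^{-r} + ε) Z`. [cite: Hastad2001, §6.1 (Thm 6.5: E3 clauses)] -/
theorem sum_deg1_le (hq : 0 < D.q) (hK : ∀ v, Fintype.card (G.Lab v) ≤ D.Kstar) (e : E) {r : ℕ}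
    (hr : r ≤ ((univ : Finset (G.Lab (G.src e))).image (G.tproj (G.src e) (edgeAt e))).card) :
    ∑ f : α → Bool, ∑ g : G.Lab (G.src e) → Bool, ∑ fl : G.Lab (G.src e) → Bool,
        (if (∀ y, maskT ⟨e, f, g, fl⟩ y = true) then (D.mult ⟨e, f, g, fl⟩ : ℝ) else 0) ≤
      D.Z * (1 / 2 ^ r + D.eps) := by
  set π := G.tproj (G.src e) (edgeAt e) with hπ
  set K := Fintype.card (G.Lab (G.src e)) with hKdef
  set N := Fintype.card α with hN
  set S := (univ : Finset (G.Lab (G.src e))).image π with hS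
  set c : ℝ := (2 * (D.q : ℝ)) ^ (D.Kstar - K) * (D.q : ℝ) ^ K with hc
  have hq0 : (0 : ℝ) < D.q := by exact_mod_cast hq
  have hε0 : 0 ≤ D.eps := by unfold eps; positivity
  have hε1 : D.eps ≤ 1 := by
    unfold eps; rw [div_le_one hq0]; exact_mod_cast D.p_le
  -- the mask is identically true iff every `y` with `f (π y)` true is flipped
  have hmask : ∀ (f : α → Bool) (g fl : G.Lab (G.src e) → Bool), (∀ y, maskT ⟨e, f, g, fl⟩ y = true) ↔
      ∀ y, f (π y) = true → fl y = true := by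
    intro f g fl
    simp only [maskT, mask, ← hπ]
    refine forall_congr' fun y => ?_
    cases f (π y) <;> simp
  -- the flip sum for fixed `f`: `∑_{fl : mask ≡ true} q^K flipWt = q^K ε^{#{y | f (π y)}}`
  have hfl : ∀ f : α → Bool, ∑ fl : G.Lab (G.src e) → Bool,
      (if (∀ y, f (π y) = true → fl y = true) then flipWt D.eps fl else 0) =
        D.eps ^ (univ.filter fun y : G.Lab (G.src e) => f (π y) = true).card := by
    intro f
    have e1 : ∀ fl : G.Lab (G.src e) → Bool,
        (if (∀ y, f (π y) = true → fl y = true) then flipWt D.eps fl else 0) =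
          ∏ y, (if (f (π y) = true → fl y = true) then bitWt D.eps (fl y) else 0) := by
      intro fl
      by_cases h : ∀ y, f (π y) = true → fl y = true
      · rw [if_pos h]
        unfold flipWt
        exact prod_congr rfl fun y _ => by rw [if_pos (h y)]
      · rw [if_neg h]
        push Not at h
        obtain ⟨y, hy, hfy⟩ := h
        exact (prod_eq_zero (mem_univ y) (by rw [if_neg]; simp [hy, hfy])).symm
    simp_rw [e1]
    rw [← Fintype.prod_sum fun y b => if (f (π y) = true → b = true) then bitWt D.eps b else 0]
    have e2 : ∀ y : G.Lab (G.src e), ∑ b : Bool, (if (f (π y) = true → b = true) then bitWt D.eps b else 0) =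
        if f (π y) = true then D.eps else 1 := by
      intro y
      rw [Fintype.sum_bool]
      cases f (π y) <;> simp [bitWt]
    simp_rw [e2]
    rw [prod_ite, prod_const, prod_const_one, mul_one]
  -- hence the weight of these triples for fixed `f`
  have hf : ∀ f : α → Bool, ∑ g : G.Lab (G.src e) → Bool, ∑ fl : G.Lab (G.src e) → Bool,
      (if (∀ y, maskT ⟨e, f, g, fl⟩ y = true) then (D.mult ⟨e, f, g, fl⟩ : ℝ) else 0) =
        (2 : ℝ) ^ K * c * D.eps ^ (univ.filter fun y : G.Lab (G.src e) => f (π y) = true).card := by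
    intro f
    have e3 : ∀ g fl : G.Lab (G.src e) → Bool,
        (if (∀ y, maskT ⟨e, f, g, fl⟩ y = true) then (D.mult ⟨e, f, g, fl⟩ : ℝ) else 0) =
          c * (if (∀ y, f (π y) = true → fl y = true) then flipWt D.eps fl else 0) := by
      intro g fl
      by_cases h : ∀ y, f (π y) = true → fl y = true
      · rw [if_pos ((hmask f g fl).2 h), if_pos h, D.mult_eq hq]
        simp only [hc, ← hKdef]
        ring
      · rw [if_neg (fun h' => h ((hmask f g fl).1 h')), if_neg h, mul_zero]
    simp_rw [e3]
    rw [← mul_sum, hfl, sum_const, card_univ, Fintype.card_fun, Fintype.card_bool, ← hKdef, nsmul_eq_mul]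
    push_cast
    ring
  simp_rw [hf]
  rw [← mul_sum]
  -- `∑_f ε^{n_f} ≤ #{f ≡ false on S} + 2^N ε ≤ 2^{N-r} + 2^N ε`
  have hpow : ∀ f : α → Bool, D.eps ^ (univ.filter fun y : G.Lab (G.src e) => f (π y) = true).card ≤
      (if (∀ x ∈ S, f x = false) then (1 : ℝ) else 0) + D.eps := by
    intro f
    by_cases h0 : ∀ x ∈ S, f x = false
    · rw [if_pos h0]
      exact (pow_le_one₀ hε0 hε1).trans (by linarith)
    · rw [if_neg h0, zero_add]
      have hne : (univ.filter fun y : G.Lab (G.src e) => f (π y) = true).card ≠ 0 := by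
        rw [card_ne_zero]
        push Not at h0
        obtain ⟨x, hx, hfx⟩ := h0
        rw [hS, mem_image] at hx
        obtain ⟨y, -, rfl⟩ := hx
        exact ⟨y, mem_filter.2 ⟨mem_univ _, by simpa using hfx⟩⟩
      obtain ⟨n, hn⟩ := Nat.exists_eq_succ_of_ne_zero hne
      rw [hn, pow_succ]
      exact mul_le_of_le_one_left hε0 (pow_le_one₀ hε0 hε1)
  have hsum : ∑ f : α → Bool, D.eps ^ (univ.filter fun y : G.Lab (G.src e) => f (π y) = true).card ≤
      (2 : ℝ) ^ N / 2 ^ r + 2 ^ N * D.eps := by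
    refine (sum_le_sum fun f _ => hpow f).trans ?_
    rw [sum_add_distrib, sum_boole, sum_const, card_univ, Fintype.card_fun, Fintype.card_bool, ← hN,
      nsmul_eq_mul]
    push_cast
    refine add_le_add ?_ le_rfl
    rw [le_div_iff₀ (by positivity)]
    calc ((univ.filter fun f : α → Bool => ∀ x ∈ S, f x = false).card : ℝ) * 2 ^ r
        ≤ ((univ.filter fun f : α → Bool => ∀ x ∈ S, f x = false).card : ℝ) * 2 ^ S.card :=
          mul_le_mul_of_nonneg_left (pow_le_pow_right₀ (by norm_num) hr) (Nat.cast_nonneg _)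
      _ = 2 ^ N := card_const_on S false
  have hZ : D.Z = (2 : ℝ) ^ K * c * 2 ^ N := by
    unfold Z
    rw [← hN, hc]
    have hsplit : (2 * (D.q : ℝ)) ^ D.Kstar = (2 * (D.q : ℝ)) ^ (D.Kstar - K) * (2 * (D.q : ℝ)) ^ K := by
      rw [← pow_add, Nat.sub_add_cancel (hK _)]
    rw [hsplit, mul_pow]
    ring
  rw [hZ]
  calc (2 : ℝ) ^ K * c * ∑ f : α → Bool, D.eps ^ (univ.filter fun y : G.Lab (G.src e) => f (π y) = true).card
      ≤ (2 : ℝ) ^ K * c * ((2 : ℝ) ^ N / 2 ^ r + 2 ^ N * D.eps) :=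
        mul_le_mul_of_nonneg_left hsum (by positivity)
    _ = (2 : ℝ) ^ K * c * 2 ^ N * (1 / 2 ^ r + D.eps) := by ring

/-! ### Clause counts of the CNF -/

omit [Fintype V] [Fintype U] [DecidableEq E] [DecidableEq U] in
/-- **The number of clauses** is the total multiplicity of the nondegenerate triples.
[cite: Hastad2001, §5 (proof of Thm 5.4)] -/
theorem length_hCNF : (D.hCNF).length = ∑ t ∈ (univ : Finset (Trip G)).filter Nondeg, D.mult t := by
  unfold hCNF
  rw [List.length_flatMap]
  simp only [List.length_replicate]
  exact Finset.sum_map_toList _ _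

omit [Fintype V] [Fintype U] [DecidableEq E] [DecidableEq U] in
/-- **The number of satisfied clauses** under `σ`. [cite: Hastad2001, §5 (proof of Thm 5.4)] -/
theorem countP_hCNF (σ : ℕ → Bool) :
    (D.hCNF).countP (fun c => Clause.eval σ c) =
      ∑ t ∈ (univ : Finset (Trip G)).filter Nondeg, (if Clause.eval σ (D.clauseT t) then D.mult t else 0) := by
  unfold hCNF
  rw [List.countP_flatMap]
  have h : (List.countP (fun c => Clause.eval σ c)) ∘ (fun t : Trip G => List.replicate (D.mult t) (D.clauseT t)) =
      fun t => if Clause.eval σ (D.clauseT t) then D.mult t else 0 := by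
    funext t
    simp [List.countP_replicate]
  rw [h]
  exact Finset.sum_map_toList _ _

/-! ### The acceptance probability for unit weights -/

omit [Fintype U] [Fintype β] [Fintype α] [DecidableEq E] [DecidableEq U] [DecidableEq β] [DecidableEq α] in
/-- A sum over Bob's vertices and the edges at them is a sum over the edges. [folklore] -/
theorem sum_vertex_edgeAt (F : ∀ v, G.EdgeAt v → ℝ) :
    ∑ v, ∑ j : G.EdgeAt v, F v j = ∑ e, F (G.src e) (edgeAt e) := by
  rw [show (∑ v, ∑ j : G.EdgeAt v, F v j) = ∑ p : (Σ v, G.EdgeAt v), F p.1 p.2 from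
    (Fintype.sum_sigma (fun p : (Σ v, G.EdgeAt v) => F p.1 p.2)).symm]
  exact Fintype.sum_equiv (Equiv.sigmaFiberEquiv G.src) _ _ (fun ⟨v, e, he⟩ => by subst he; rfl)

omit [Fintype U] [DecidableEq E] [DecidableEq U] in
/-- For unit weights the test picks a uniformly random edge:
`testAcc = (∑_e accProb_e) / |E|`. [cite: Hastad2001, §6.1 (Test 3S, step 1)] -/
theorem testAcc_unit (hunit : ∀ e, G.wt e = 1) (ε : ℝ) (A : U → (α → Bool) → Bool)
    (B : ∀ v, (G.Lab v → Bool) → Bool) :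
    G.testAcc ε A B = (∑ e, accProb ε (G.tproj (G.src e) (edgeAt e)) (A (G.dst e)) (B (G.src e))) /
      Fintype.card E := by
  have htot : G.total = Fintype.card E := by
    unfold total; simp [hunit]
  unfold testAcc vertexAcc wAt
  simp only [hunit]
  have e1 : ∀ v, G.wV v / G.total * ∑ j : G.EdgeAt v, 1 / G.wV v * accProb ε (G.tproj v j) (A (G.dst j.1)) (B v) =
      ∑ j : G.EdgeAt v, accProb ε (G.tproj v j) (A (G.dst j.1)) (B v) / Fintype.card E := by
    intro v
    rw [mul_sum]
    refine sum_congr rfl fun j _ => ?_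
    rw [htot]
    field_simp [(G.wV_pos v).ne']
  simp_rw [e1]
  rw [sum_vertex_edgeAt (fun v j => accProb ε (G.tproj v j) (A (G.dst j.1)) (B v) / Fintype.card E),
    sum_div]
  rfl

/-! ### The value bound -/

omit [Fintype V] [Fintype U] [DecidableEq E] [DecidableEq U] in
/-- Splitting a sum over all triples into nondegenerate, mask-false and mask-true triples (the last two
are disjoint because label sets are nonempty). [folklore] -/
theorem sum_trip_split (y0 : ∀ v, G.Lab v) (F : Trip G → ℝ) :
    ∑ t, F t = (∑ t ∈ (univ : Finset (Trip G)).filter Nondeg, F t) +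
      (∑ t, if (∀ y, maskT t y = false) then F t else 0) + ∑ t, if (∀ y, maskT t y = true) then F t else 0 := by
  have hnd : ∀ t : Trip G, Nondeg t ↔ ¬ ((∀ y, maskT t y = false) ∨ (∀ y, maskT t y = true)) := by
    intro t
    unfold Nondeg
    constructor
    · rintro ⟨⟨y1, hy1⟩, ⟨y0', hy0⟩⟩ (h | h)
      · simp [h y1] at hy1
      · simp [h y0'] at hy0
    · intro h
      push Not at h
      obtain ⟨⟨y1, hy1⟩, ⟨y0', hy0⟩⟩ := h
      exact ⟨⟨y1, by simpa using hy1⟩, ⟨y0', by simpa using hy0⟩⟩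
  have hdisj : ∀ t : Trip G, ¬ ((∀ y, maskT t y = false) ∧ (∀ y, maskT t y = true)) := by
    rintro t ⟨h0, h1⟩
    have := h0 (y0 _)
    rw [h1] at this
    simp at this
  rw [← sum_filter_add_sum_filter_not univ (Nondeg (G := G)), add_assoc]
  congr 1
  rw [sum_filter, ← sum_add_distrib]
  refine sum_congr rfl fun t _ => ?_
  by_cases h0 : ∀ y, maskT t y = false
  · have h1 : ¬ ∀ y, maskT t y = true := fun h1 => hdisj t ⟨h0, h1⟩
    have hn : ¬ Nondeg t := fun hn => (hnd t).1 hn (Or.inl h0)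
    rw [if_pos hn, if_pos h0, if_neg h1, add_zero]
  · by_cases h1 : ∀ y, maskT t y = true
    · have hn : ¬ Nondeg t := fun hn => (hnd t).1 hn (Or.inr h1)
      rw [if_pos hn, if_neg h0, if_pos h1, zero_add]
    · have hn : Nondeg t := (hnd t).2 (by tauto)
      rw [if_neg (not_not.2 hn), if_neg h0, if_neg h1, add_zero]

omit [Fintype U] [DecidableEq E] [DecidableEq U] in
/-- **The value bound** (Håstad 2001, Thm 6.5 at formula level): for a unit-weight game `G`, `ε = p/q ≤ 1/4`,
`K ≤ K⋆`, projection images of size `≥ r ≥ 3`, if every pair of families of folded tables passes the test with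
probability at most `τ ≤ 1`, then every assignment satisfies at most a fraction `τ + 2/2^r` of the clauses of
`hCNF`, which is nonempty. [cite: Hastad2001, Thm 6.5] -/
theorem satisfiedFraction_hCNF_le [Nonempty E] (hunit : ∀ e, G.wt e = 1) (hq : 0 < D.q)
    (hp4 : 4 * D.p ≤ D.q) (hK : ∀ v, Fintype.card (G.Lab v) ≤ D.Kstar) {r : ℕ} (hr3 : 3 ≤ r)
    (hr : ∀ e, r ≤ ((univ : Finset (G.Lab (G.src e))).image (G.tproj (G.src e) (edgeAt e))).card)
    {τ : ℝ} (hτ1 : τ ≤ 1)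
    (hτ : ∀ (A : U → (α → Bool) → Bool) (B : ∀ v, (G.Lab v → Bool) → Bool),
      (∀ u, IsFolded (A u)) → (∀ v, IsFolded (B v)) → G.testAcc D.eps A B ≤ τ)
    (σ : ℕ → Bool) :
    0 < (D.hCNF).length ∧ ((D.hCNF).satisfiedFraction σ : ℝ) ≤ τ + 2 / 2 ^ r := by
  set A := D.tabA σ with hA
  set B := D.tabB σ with hB
  set TOT : ℝ := ∑ t : Trip G, (D.mult t : ℝ) with hTOT
  set ALL : ℝ := ∑ t : Trip G, (D.mult t : ℝ) * accInd (A (G.dst t.1) t.2.1) (B (G.src t.1) t.2.2.1)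
    (B (G.src t.1) (shift t.2.2.1 (maskT t))) with hALL
  set D0 : ℝ := ∑ t : Trip G, if (∀ y, maskT t y = false) then (D.mult t : ℝ) else 0 with hD0
  set D1 : ℝ := ∑ t : Trip G, if (∀ y, maskT t y = true) then (D.mult t : ℝ) else 0 with hD1
  set LEN : ℝ := ∑ t ∈ (univ : Finset (Trip G)).filter Nondeg, (D.mult t : ℝ) with hLEN
  set SAT : ℝ := ∑ t ∈ (univ : Finset (Trip G)).filter Nondeg,
    (if Clause.eval σ (D.clauseT t) then (D.mult t : ℝ) else 0) with hSAT
  have hq0 : (0 : ℝ) < D.q := by exact_mod_cast hq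
  have hε : D.eps ≤ 1 / 4 := by
    unfold eps
    rw [div_le_div_iff₀ hq0 (by norm_num)]
    have : (4 * D.p : ℕ) ≤ D.q := hp4
    have : ((4 * D.p : ℕ) : ℝ) ≤ D.q := by exact_mod_cast this
    push_cast at this
    linarith
  have hZ0 : 0 < D.Z := by unfold Z; positivity
  have hEpos : (0 : ℝ) < Fintype.card E := by exact_mod_cast Fintype.card_pos
  -- totals edge by edge
  have hTOTeq : TOT = D.Z * Fintype.card E := by
    rw [hTOT, Fintype.sum_sigma]
    have : ∀ e : E, ∑ y : (α → Bool) × (G.Lab (G.src e) → Bool) × (G.Lab (G.src e) → Bool),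
        (D.mult ⟨e, y⟩ : ℝ) = D.Z := by
      intro e
      rw [Fintype.sum_prod_type]
      simp_rw [Fintype.sum_prod_type]
      exact D.sum_mult hq hK e
    simp_rw [this]
    simp [mul_comm]
  have hALLle : ALL ≤ TOT * τ := by
    have hacc : ALL = D.Z * ∑ e, accProb D.eps (G.tproj (G.src e) (edgeAt e)) (A (G.dst e)) (B (G.src e)) := by
      rw [hALL, Fintype.sum_sigma, mul_sum]
      refine sum_congr rfl fun e _ => ?_
      rw [Fintype.sum_prod_type]
      simp_rw [Fintype.sum_prod_type]
      exact D.sum_mult_accInd hq hK e (A (G.dst e)) (B (G.src e))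
    have ht := hτ A B (fun u => D.isFolded_tabA σ u) (fun v => D.isFolded_tabB σ v)
    rw [testAcc_unit hunit, div_le_iff₀ hEpos] at ht
    rw [hacc, hTOTeq]
    calc D.Z * ∑ e, accProb D.eps (G.tproj (G.src e) (edgeAt e)) (A (G.dst e)) (B (G.src e))
        ≤ D.Z * (τ * Fintype.card E) := mul_le_mul_of_nonneg_left ht hZ0.le
      _ = D.Z * Fintype.card E * τ := by ring
  have hD0le : D0 ≤ TOT / 2 ^ r := by
    rw [hD0, hTOTeq, Fintype.sum_sigma]
    have : ∀ e : E, ∑ y : (α → Bool) × (G.Lab (G.src e) → Bool) × (G.Lab (G.src e) → Bool),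
        (if (∀ z, maskT ⟨e, y⟩ z = false) then (D.mult ⟨e, y⟩ : ℝ) else 0) ≤ D.Z / 2 ^ r := by
      intro e
      rw [Fintype.sum_prod_type]
      simp_rw [Fintype.sum_prod_type]
      exact D.sum_deg0_le hq hK e (hr e)
    refine (sum_le_sum fun e _ => this e).trans ?_
    rw [sum_const, card_univ, nsmul_eq_mul]
    ring_nf
    exact le_rfl
  have hD1le : D1 ≤ TOT * (1 / 2 ^ r + D.eps) := by
    rw [hD1, hTOTeq, Fintype.sum_sigma]
    have : ∀ e : E, ∑ y : (α → Bool) × (G.Lab (G.src e) → Bool) × (G.Lab (G.src e) → Bool),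
        (if (∀ z, maskT ⟨e, y⟩ z = true) then (D.mult ⟨e, y⟩ : ℝ) else 0) ≤ D.Z * (1 / 2 ^ r + D.eps) := by
      intro e
      rw [Fintype.sum_prod_type]
      simp_rw [Fintype.sum_prod_type]
      exact D.sum_deg1_le hq hK e (hr e)
    refine (sum_le_sum fun e _ => this e).trans ?_
    rw [sum_const, card_univ, nsmul_eq_mul]
    ring_nf
    exact le_rfl
  -- the accepted weight of the kept clauses
  have hSATle : SAT ≤ ALL - D1 := by
    have hsplit := sum_trip_split D.yB fun t => (D.mult t : ℝ) * accInd (A (G.dst t.1) t.2.1)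
      (B (G.src t.1) t.2.2.1) (B (G.src t.1) (shift t.2.2.1 (maskT t)))
    have hS : SAT = ∑ t ∈ (univ : Finset (Trip G)).filter Nondeg, (D.mult t : ℝ) *
        accInd (A (G.dst t.1) t.2.1) (B (G.src t.1) t.2.2.1) (B (G.src t.1) (shift t.2.2.1 (maskT t))) := by
      rw [hSAT]
      refine sum_congr rfl fun t _ => ?_
      rw [D.eval_clauseT σ t]
      unfold accInd
      split_ifs <;> simp
    have h1 : ∑ t : Trip G, (if (∀ y, maskT t y = true) then (D.mult t : ℝ) * accInd (A (G.dst t.1) t.2.1)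
        (B (G.src t.1) t.2.2.1) (B (G.src t.1) (shift t.2.2.1 (maskT t))) else 0) = D1 := by
      rw [hD1]
      refine sum_congr rfl fun t _ => ?_
      by_cases h : ∀ y, maskT t y = true
      · rw [if_pos h, if_pos h, accInd_deg1 (D.isFolded_tabB σ _) _ _ _ h, mul_one]
      · rw [if_neg h, if_neg h]
    have h0 : 0 ≤ ∑ t : Trip G, (if (∀ y, maskT t y = false) then (D.mult t : ℝ) * accInd (A (G.dst t.1) t.2.1)
        (B (G.src t.1) t.2.2.1) (B (G.src t.1) (shift t.2.2.1 (maskT t))) else 0) :=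
      sum_nonneg fun t _ => by
        unfold accInd
        split_ifs <;> positivity
    rw [hS]
    rw [h1] at hsplit
    linarith
  have hLENeq : LEN = TOT - D0 - D1 := by
    have hsplit := sum_trip_split D.yB fun t => (D.mult t : ℝ)
    rw [hLEN, hTOT, hsplit, hD0, hD1]
    ring
  -- arithmetic
  have hTOTpos : 0 < TOT := by rw [hTOTeq]; positivity
  have hr8 : (1 : ℝ) / 2 ^ r ≤ 1 / 8 := by
    rw [div_le_div_iff₀ (by positivity) (by norm_num), one_mul, one_mul]
    calc (8 : ℝ) = 2 ^ 3 := by norm_num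
      _ ≤ 2 ^ r := pow_le_pow_right₀ (by norm_num) hr3
  have hD0' : D0 ≤ TOT / 8 := by
    refine hD0le.trans ?_
    rw [div_eq_mul_one_div, div_eq_mul_one_div TOT 8]
    exact mul_le_mul_of_nonneg_left hr8 hTOTpos.le
  have hD1' : D1 ≤ TOT * (3 / 8) := hD1le.trans (mul_le_mul_of_nonneg_left (by linarith) hTOTpos.le)
  have hD0nn : 0 ≤ D0 := sum_nonneg fun t _ => by split_ifs <;> positivity
  have hD1nn : 0 ≤ D1 := sum_nonneg fun t _ => by split_ifs <;> positivity
  have hLENpos : TOT / 2 ≤ LEN := by rw [hLENeq]; linarith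
  have hLEN0 : 0 < LEN := by linarith
  -- the length is positive
  have hlenR : ((D.hCNF).length : ℝ) = LEN := by
    rw [D.length_hCNF]; push_cast; rfl
  have hlenpos : 0 < (D.hCNF).length := by
    have : (0 : ℝ) < (D.hCNF).length := by rw [hlenR]; exact hLEN0
    exact_mod_cast this
  refine ⟨hlenpos, ?_⟩
  -- the fraction
  have hfrac : ((D.hCNF).satisfiedFraction σ : ℝ) = SAT / LEN := by
    unfold CNF.satisfiedFraction CNF.numClauses
    rw [if_neg hlenpos.ne']
    push_cast
    rw [hlenR, D.countP_hCNF σ]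
    push_cast
    rfl
  rw [hfrac, div_le_iff₀ hLEN0]
  have hτD1 : τ * D1 ≤ D1 := mul_le_of_le_one_left hD1nn hτ1
  have hτD0 : τ * D0 ≤ D0 := mul_le_of_le_one_left hD0nn hτ1
  have hcD0 : D0 ≤ 2 / 2 ^ r * LEN := by
    have h1 : (2 : ℝ) / 2 ^ r * (TOT / 2) ≤ 2 / 2 ^ r * LEN := mul_le_mul_of_nonneg_left hLENpos (by positivity)
    have h2 : (2 : ℝ) / 2 ^ r * (TOT / 2) = TOT / 2 ^ r := by ring
    linarith
  have hALL' : ALL ≤ τ * TOT := by linarith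
  have e : (τ + 2 / 2 ^ r) * LEN = τ * TOT - τ * D0 - τ * D1 + 2 / 2 ^ r * LEN := by rw [hLENeq]; ring
  rw [e]
  linarith

end CNFData

end ProjGame

end Literature.Computability.Complexity

end
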